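import Summits.RiemannHypothesis.RiemannHypothesis.Theorems.GroundBartaEvenWinsBeyondArchLatticeRippleTaylorCells
import Summits.RiemannHypothesis.RiemannHypothesis.Theorems.GroundBartaEvenWinsBeyondArchLatticeRippleSum
import HarnessLib

/-!
# RiemannHypothesis / GroundBarta machinery — LATTICE RIPPLES: the chain layer (1/2)

Helper file (`--supports stmt-RiemannHypothesis-18085`; infrastructure for the Weil-positivity ladder), RH-free, axioms
standard.  Seat rh-explicit-weil-1.  Chain assembly for the lattice-ripple cells `XTCell` of `…LatticeRippleTaylorCells.lean`, by
verbatim adaptation of the two-prime chain layer `WeilTwoPrimeMinorant.lean` (there: cells of `w₂₃`; here: cells of a cosine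
sum `P(t) = Σ_r A_r cos(t(j_r log 2 + k_r log 3))`, no level constant):

* `XTCell.rippleSum_eq_ripplesVal` (the cosine sum `ripplesVal` of a ripple list lives in `…LatticeRippleSum.lean`);
* `xSigmaAux cells s = Σ_j 1_{[u_j,v_j)}(s) σ_{X,j}(s)` on `[0, ∞)` and the even function `cellsSigmaX cells t = xSigmaAux |t|`;
* `checkChainX`, the check-free validity predicate `XCellsOK rs T cells` (chain from `0` to `T`, every cell valid, every cell
  carries the ripple list `rs`), the integer checker `checkXCells` and `xCellsOK_of_checkXCells`;
* soundness `cellsSigmaX_le_ripplesVal` (`σ_X(t) ≤ P(t)` for `|t| < T`), `cellsSigmaX_eq_zero` (`= 0` for `|t| ≥ T`),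
  boundedness, measurability, evenness.
Moments and sup bounds are in `…LatticeRippleChainMoments.lean` (2/2).  Everything here is proved; no named facts.
-/

set_option linter.dupNamespace false

noncomputable section

open Complex Filter Set MeasureTheory
open scoped Real Topology

namespace Summit.RiemannHypothesis.RiemannHypothesis.Theorems.EvenWinsBeyondArch

open Literature.NumberTheory.LFunctions

/-- A cell's ripple sum is the cosine sum of its ripple data. [folklore] -/
theorem XTCell.rippleSum_eq_ripplesVal (c : XTCell) (t : ℝ) : c.rippleSum t = ripplesVal c.ripples t := by
  unfold XTCell.rippleSum XTCell.ripples ripplesVal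
  rw [List.map_map]
  congr 1

/-! ## The piecewise function built from a chain of lattice-ripple cells -/

/-- `σ_X` on `[0, ∞)`: `Σ_j 1_{[u_j, v_j)}(s) σ_{X,j}(s)`. [folklore] -/
def xSigmaAux : List XTCell → ℝ → ℝ
  | [], _ => 0
  | c :: cs, s => Set.indicator (Ico (c.u : ℝ) c.v) (fun s ↦ c.sigma s) s + xSigmaAux cs s

/-- The even function `σ_X(t) = σ_{X,≥0}(|t|)`. [folklore] -/
def cellsSigmaX (cells : List XTCell) (t : ℝ) : ℝ := xSigmaAux cells |t|

/-- The cells are consecutive: `u_0 = s`, `u_{j+1} = v_j`, last `v = T`. [folklore] -/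
def checkChainX : List XTCell → ℚ → ℚ → Bool
  | [], s, T => decide (s = T)
  | c :: cs, s, T => decide (c.u = s) && checkChainX cs c.v T

/-- A valid lattice-ripple chain on `[0, T]` for the ripple list `rs`: consecutive valid cells from `0` to `T`, each
carrying exactly the ripples `rs`. [folklore] -/
structure XCellsOK (rs : List (ℤ × ℤ × ℚ)) (T : ℚ) (cells : List XTCell) : Prop where
  /-- the cells form a chain from `0` to `T` -/
  chain : checkChainX cells 0 T = true
  /-- every cell is valid -/
  valid : ∀ c ∈ cells, c.Valid
  /-- every cell carries the ripple list `rs` -/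
  ripples : ∀ c ∈ cells, c.ripples = rs

/-- **The integer checker of a lattice-ripple chain**: chain from `0` to `T`, every cell `checkZ`, every cell's ripple
data equal to `rs`. [folklore] -/
def checkXCells (rs : List (ℤ × ℤ × ℚ)) (T : ℚ) (cells : List XTCell) : Bool :=
  checkChainX cells 0 T && cells.all (fun c ↦ c.checkZ) && cells.all (fun c ↦ decide (c.ripples = rs))

/-- The integer checker yields a valid chain. [folklore] -/
theorem xCellsOK_of_checkXCells {rs : List (ℤ × ℤ × ℚ)} {T : ℚ} {cells : List XTCell}
    (h : checkXCells rs T cells = true) : XCellsOK rs T cells := by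
  simp only [checkXCells, Bool.and_eq_true, List.all_eq_true, decide_eq_true_eq] at h
  obtain ⟨⟨hchain, hall⟩, hrs⟩ := h
  exact ⟨hchain, fun c hc ↦ (XTCell.valid_of_checkZ (hall c hc)).1, hrs⟩

section Chain

/-- A chain of valid cells from `s` to `T` has `s ≤ T` and all cells inside `[s, T]`. [folklore] -/
theorem chain_boundsX {cells : List XTCell} {s T : ℚ} (hchain : checkChainX cells s T = true)
    (hall : ∀ c ∈ cells, c.Valid) :
    s ≤ T ∧ ∀ c ∈ cells, s ≤ c.u ∧ c.v ≤ T := by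
  induction cells generalizing s with
  | nil =>
    simp only [checkChainX, decide_eq_true_eq] at hchain
    exact ⟨hchain.le, fun c hc ↦ by simp at hc⟩
  | cons c cs ih =>
    simp only [checkChainX, Bool.and_eq_true, decide_eq_true_eq] at hchain
    have hc := hall c (by simp)
    have huv := hc.u_lt_v
    have ih' := ih hchain.2 fun c' hc' ↦ hall c' (by simp [hc'])
    refine ⟨by rw [← hchain.1]; exact huv.le.trans ih'.1, fun c' hc' ↦ ?_⟩
    simp only [List.mem_cons] at hc'
    rcases hc' with rfl | hc'
    · exact ⟨hchain.1.ge, ih'.1⟩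
    · have := ih'.2 c' hc'
      exact ⟨hchain.1 ▸ huv.le.trans this.1, this.2⟩

/-- `σ_{X,≥0}` vanishes off `[s, T)`. [folklore] -/
theorem xSigmaAux_eq_zero {cells : List XTCell} {s T : ℚ} (hchain : checkChainX cells s T = true)
    (hall : ∀ c ∈ cells, c.Valid) {x : ℝ} (hx : x < s ∨ (T : ℝ) ≤ x) :
    xSigmaAux cells x = 0 := by
  induction cells generalizing s with
  | nil => rfl
  | cons c cs ih =>
    have hb := chain_boundsX hchain hall
    simp only [checkChainX, Bool.and_eq_true, decide_eq_true_eq] at hchain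
    have hcv : (c.v : ℝ) ≤ T := by exact_mod_cast (hb.2 c (by simp)).2
    have huv : (c.u : ℝ) < c.v := by exact_mod_cast (hall c (by simp)).u_lt_v
    have hus : (c.u : ℝ) = s := by exact_mod_cast hchain.1
    simp only [xSigmaAux]
    rw [ih hchain.2 (fun c' hc' ↦ hall c' (by simp [hc'])) ?_, add_zero, Set.indicator_of_notMem]
    · rintro ⟨h1, h2⟩
      rcases hx with hx | hx <;> linarith
    · rcases hx with hx | hx
      · left; linarith
      · right; exact hx

/-- On `[s, T)`, `σ_{X,≥0}(x) = σ_{X,j}(x)` for the cell containing `x`. [folklore] -/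
theorem xSigmaAux_spec {cells : List XTCell} {s T : ℚ} (hchain : checkChainX cells s T = true)
    (hall : ∀ c ∈ cells, c.Valid) {x : ℝ} (h1 : (s : ℝ) ≤ x) (h2 : x < T) :
    ∃ c ∈ cells, (c.u : ℝ) ≤ x ∧ x < c.v ∧ xSigmaAux cells x = c.sigma x := by
  induction cells generalizing s with
  | nil =>
    simp only [checkChainX, decide_eq_true_eq] at hchain
    rw [hchain] at h1
    linarith
  | cons c cs ih =>
    simp only [checkChainX, Bool.and_eq_true, decide_eq_true_eq] at hchain
    have hus : (c.u : ℝ) = s := by exact_mod_cast hchain.1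
    have hall' : ∀ c' ∈ cs, c'.Valid := fun c' hc' ↦ hall c' (by simp [hc'])
    by_cases hxv : x < c.v
    · refine ⟨c, by simp, by linarith, hxv, ?_⟩
      simp only [xSigmaAux]
      have hmem : x ∈ Ico (c.u : ℝ) c.v := ⟨by linarith, hxv⟩
      rw [xSigmaAux_eq_zero hchain.2 hall' (Or.inl hxv), add_zero, Set.indicator_of_mem hmem]
    · push Not at hxv
      obtain ⟨c', hc', hr⟩ := ih hchain.2 hall' hxv
      refine ⟨c', by simp [hc'], hr.1, hr.2.1, ?_⟩
      simp only [xSigmaAux]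
      rw [Set.indicator_of_notMem (fun h ↦ not_lt.2 hxv h.2), zero_add, hr.2.2]

end Chain

/-! ## Boundedness and measurability -/

/-- `σ_{X,≥0}` is bounded. [folklore] -/
theorem exists_abs_xSigmaAux_le (cells : List XTCell) : ∃ B, ∀ x, |xSigmaAux cells x| ≤ B := by
  induction cells with
  | nil => exact ⟨0, fun x ↦ by simp [xSigmaAux]⟩
  | cons c cs ih =>
    obtain ⟨B, hB⟩ := ih
    obtain ⟨C, hC⟩ := (isCompact_Icc (a := (c.u : ℝ)) (b := c.v)).exists_bound_of_continuousOn
      (c.continuous_sigma.continuousOn (s := Icc (c.u : ℝ) c.v))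
    refine ⟨max C 0 + B, fun x ↦ ?_⟩
    simp only [xSigmaAux]
    refine (abs_add_le _ _).trans (add_le_add ?_ (hB x))
    by_cases hx : x ∈ Ico (c.u : ℝ) c.v
    · rw [Set.indicator_of_mem hx]
      have := hC x (Ico_subset_Icc_self hx)
      rw [Real.norm_eq_abs] at this
      exact this.trans (le_max_left _ _)
    · rw [Set.indicator_of_notMem hx, abs_zero]
      exact le_max_right _ _

/-- `σ_X` is bounded. [folklore] -/
theorem exists_abs_cellsSigmaX_le (cells : List XTCell) : ∃ B, 0 ≤ B ∧ ∀ t, |cellsSigmaX cells t| ≤ B := by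
  obtain ⟨B, hB⟩ := exists_abs_xSigmaAux_le cells
  exact ⟨B, (abs_nonneg _).trans (hB 0), fun t ↦ hB |t|⟩

/-- `σ_{X,≥0}` is measurable. [folklore] -/
theorem measurable_xSigmaAux (cells : List XTCell) : Measurable (xSigmaAux cells) := by
  induction cells with
  | nil => exact measurable_const
  | cons c cs ih =>
    change Measurable fun s ↦ Set.indicator (Ico (c.u : ℝ) c.v) (fun s ↦ c.sigma s) s + xSigmaAux cs s
    exact (c.continuous_sigma.measurable.indicator measurableSet_Ico).add ih

/-- `σ_X` is measurable. [folklore] -/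
theorem measurable_cellsSigmaX (cells : List XTCell) : Measurable (cellsSigmaX cells) :=
  (measurable_xSigmaAux cells).comp continuous_abs.measurable

/-- `σ_X` is even. [folklore] -/
theorem cellsSigmaX_neg (cells : List XTCell) (t : ℝ) : cellsSigmaX cells (-t) = cellsSigmaX cells t := by
  unfold cellsSigmaX; rw [abs_neg]

section Sound

variable {rs : List (ℤ × ℤ × ℚ)} {T : ℚ} {cells : List XTCell}

/-- **Soundness of a certified lattice-ripple minorant**: `σ_X(t) ≤ P(t)` for `|t| < T`. [folklore] -/
theorem cellsSigmaX_le_ripplesVal (h : XCellsOK rs T cells) {t : ℝ} (ht : |t| < T) :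
    cellsSigmaX cells t ≤ ripplesVal rs t := by
  unfold cellsSigmaX
  obtain ⟨c, hc, hux, hxv, hval⟩ := xSigmaAux_spec h.chain h.valid (by exact_mod_cast abs_nonneg t) ht
  rw [hval, ← ripplesVal_abs, ← h.ripples c hc, ← XTCell.rippleSum_eq_ripplesVal]
  exact (h.valid c hc).sigma_le |t| hux hxv.le

/-- `σ_X(t) = 0` for `|t| ≥ T`. [folklore] -/
theorem cellsSigmaX_eq_zero (h : XCellsOK rs T cells) {t : ℝ} (ht : (T : ℝ) ≤ |t|) :
    cellsSigmaX cells t = 0 :=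
  xSigmaAux_eq_zero h.chain h.valid (Or.inr ht)

/-- `0 ≤ T` for a valid chain. [folklore] -/
theorem XCellsOK.T_nonneg (h : XCellsOK rs T cells) : 0 ≤ T := (chain_boundsX h.chain h.valid).1

end Sound

end Summit.RiemannHypothesis.RiemannHypothesis.Theorems.EvenWinsBeyondArch

end
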